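/-
Copyright (c) 2026. All rights reserved.
Released under Apache 2.0 license as described in the file LICENSE.
Authors: abc-iut cell, seat abc-iut-w5-d053 (gen 4; row «COR37-LOGOBS-GLUE», part (b) of abc-iut-L4-t5's
«COR37-COMPAT-LITERAL» split — the cross identities as natural transformations).
-/
import Literature.AnabelianGeometry.AbsoluteAnabelian.AbsTopIII.BiAnabelianLogGlueEta
import HarnessLib

/-!
# [AbsTopIII] Cor 3.7 (iii), second clause — the CROSS IDENTITIES between the core family `K₀` over `𝔈` and the
# cell homotopies of `𝔖†_log`, as natural transformations

S. Mochizuki, *Topics in absolute anabelian geometry III* [MochizukiAbsTopIII2015] (kurims manuscript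
`paper:url-5493eb38cbb7`), Cor 3.7 (iii) p. 88, Def 3.5 (ii) p. 75 (whiskering law of a family of homotopies).

Continuation of `BiAnabelianLogGlueEta.lean`.  PROOF-ONLY.  abc-iut-L4-t5's componentwise cross lemmas
`coresFamily_η_timesGal_app` (p448024; hypothesis (H×): `ι_×` lies over the canonical identification of Galois
groups, `(𝒩 → 𝔈)(ι_×) = lamTimesGal ≫ lamTimesPfGal⁻¹`) and `coresFamily_η_logGal_app` (p453334; hypothesis (Hlog) for
`ι_log`) are transported to heterogeneous equalities of natural transformations between `K₀`'s homotopy on a cell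
pair post-whiskered into `𝔈` and `cellη g ▷ (𝒩 → 𝔈)` (`coresFamily_η_cellGal_heq`) — the form in which the
whiskering law of the glued family consumes them (`BiAnabelianLogGlueLaws.lean`).

HONEST FRAMING: bookkeeping over the cell's typing of refereed pre-IUT material; (H×)/(Hlog) are displayed
hypotheses (TRUE at the model: abc-iut-L4-t5's `modelSetting_iotaTimes_overGal` / `modelSetting_iotaLog_overGal`,
p447746), no `Prop` fact; nothing here bears on [IUTchIII] Cor. 3.12.
-/

set_option autoImplicit false

namespace Literature.AnabelianGeometry.AbsoluteAnabelian.AbsTopIII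

open CategoryTheory Quiver
open Literature.AnabelianGeometry.AbsoluteAnabelian.DiagramOfCategories

universe u

namespace BiAnabelianSetting

open StarGlue

variable {X E N : Type u} [Category.{u} X] [Category.{u} E] [Category.{u} N]
  (𝔖 : BiAnabelianSetting X E N)

/-! ### Bookkeeping -/

/-- An `eqToHom`-sandwich is heterogeneously its core (abc-iut-L4-t5's lemma, short name).
[cite: MochizukiAbsTopIII2015, Definition 3.5 (ii) p.75] -/
private theorem sw {A : Type*} [Category A] {a a' b b' : A} (ha : a = a') (hb : b' = b) (f : a' ⟶ b') :
    HEq (eqToHom ha ≫ f ≫ eqToHom hb) f :=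
  HomotopyFamily.heq_eqToHom_comp_comp_eqToHom ha hb f

/-- Two natural transformations between respectively equal functors whose components agree up to the
`eqToHom`s are heterogeneously equal (bookkeeping for Def. 3.5 (ii) families).
[cite: MochizukiAbsTopIII2015, Definition 3.5 (ii) p.75] -/
theorem natTrans_heq_of_app_eq {C D : Type*} [Category C] [Category D] {F G F' G' : C ⥤ D} (hF : F = F')
    (hG : G = G') (α : F ⟶ G) (α' : F' ⟶ G')
    (h : ∀ x, α.app x = eqToHom (Functor.congr_obj hF x) ≫ α'.app x ≫ eqToHom (Functor.congr_obj hG x).symm) :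
    HEq α α' := by
  subst hF hG
  refine heq_of_eq (NatTrans.ext (funext fun x => ?_))
  simpa using h x

/-- Re-indexing a homotopy of `K₀` along equal pairs of paths (heterogeneously).
[cite: MochizukiAbsTopIII2015, Definition 3.5 (ii) p.75] -/
theorem coresFamily_η_heq_congr {a b : Cor37Vertex} {P P' Q Q' : StarPath.{u} a b} (hP : P = P') (hQ : Q = Q')
    (h : 𝔖.coresFamily.E P Q) (h' : 𝔖.coresFamily.E P' Q') : HEq (𝔖.coresFamily.η h) (𝔖.coresFamily.η h') := by
  subst hP hQ; rfl

/-! ### The cross identities: `K₀` on a cell pair post-whiskered into `𝔈` -/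

/-- **Cross identity, type (2)** (abc-iut-L4-t5's `coresFamily_η_timesGal_app`, p448024, as natural
transformations): under (H×), `K₀`'s homotopy at `([toGal]∘[λ^×]∘[r], [toGal]∘[λ^{×pf}]∘[r])` is
`(𝒟*_[r] ◁ ι_×) ▷ (𝒩 → 𝔈)`. [cite: MochizukiAbsTopIII2015, Cor 3.7 (iii) p.88] -/
theorem coresFamily_η_timesGal_heq
    (hT : ∀ y : X, 𝔖.spaceGal.map (𝔖.iotaTimes.app y) = 𝔖.lamTimesGal.hom.app y ≫ 𝔖.lamTimesPfGal.inv.app y)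
    {c : Cor37Vertex} (r : StarPath.{u} c Cor37Vertex.box)
    (m : 𝔖.coresFamily.E ((r.cons Cor37Edge.lamTimes).cons Cor37Edge.toGal)
      ((r.cons Cor37Edge.lamTimesPf).cons Cor37Edge.toGal)) :
    HEq (𝔖.coresFamily.η m)
      (Functor.whiskerRight (Functor.whiskerLeft (𝔖.starDiagram.pathFunctor' r) 𝔖.iotaTimes) 𝔖.spaceGal) := by
  refine natTrans_heq_of_app_eq (by rw [pathFunctor_eq_pathFunctor']; rfl)
    (by rw [pathFunctor_eq_pathFunctor']; rfl) _ _ fun x => ?_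
  have hx : (𝔖.starDiagram.pathFunctor r).obj x = (𝔖.starDiagram.pathFunctor' r).obj x :=
    Functor.congr_obj (pathFunctor_eq_pathFunctor' _ r) x
  rw [𝔖.coresFamily_η_timesGal_app hT r m x, NatTrans.congr 𝔖.iotaTimes hx]
  simp only [Functor.map_comp, eqToHom_map]
  refine (conj_eqToHom_iff_heq' _ _ _ _).2 ?_
  exact (sw _ _ _).trans (sw _ _ _)

/-- **Cross identity, type (1)** (abc-iut-L4-t5's `coresFamily_η_logGal_app`, p453334, as natural
transformations): under (Hlog), `K₀`'s homotopy at `([toGal]∘[λ^×]∘[pr_⋎]∘[log_𝒳]∘[r], [toGal]∘[λ^{×pf}]∘[pr_{⋎+1}]∘[r])`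
is `(𝒟*_[r] ◁ ι_{log,⋎}) ▷ (𝒩 → 𝔈)`. [cite: MochizukiAbsTopIII2015, Cor 3.7 (iii) p.88] -/
theorem coresFamily_η_logGal_heq
    (hL : ∀ A : X, 𝔖.spaceGal.map (𝔖.iotaLog.app A) =
      𝔖.lamTimesGal.hom.app (𝔖.log.obj A) ≫ 𝔖.logGal.hom.app A ≫ 𝔖.lamTimesPfGal.inv.app A)
    {c : Cor37Vertex} (n : ℤ) (r : StarPath.{u} c (Cor37Vertex.first (n + 1)))
    (m : 𝔖.coresFamily.E
      ((((r.cons (Cor37Edge.log (n + 1) n rfl)).cons (Cor37Edge.pr n)).cons Cor37Edge.lamTimes).cons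
        Cor37Edge.toGal)
      (((r.cons (Cor37Edge.pr (n + 1))).cons Cor37Edge.lamTimesPf).cons Cor37Edge.toGal)) :
    HEq (𝔖.coresFamily.η m)
      (Functor.whiskerRight (Functor.whiskerLeft (𝔖.starDiagram.pathFunctor' r) 𝔖.iotaLogAt) 𝔖.spaceGal) := by
  refine natTrans_heq_of_app_eq (by rw [pathFunctor_eq_pathFunctor']; rfl)
    (by rw [pathFunctor_eq_pathFunctor']; rfl) _ _ fun x => ?_
  have hx : ((𝔖.starDiagram.pathFunctor r).obj x).fst = ((𝔖.starDiagram.pathFunctor' r).obj x).fst := by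
    rw [pathFunctor_eq_pathFunctor']
  rw [𝔖.coresFamily_η_logGal_app hL n r m x, NatTrans.congr 𝔖.iotaLog hx]
  simp only [Functor.map_comp, eqToHom_map]
  refine (conj_eqToHom_iff_heq' _ _ _ _).2 ?_
  exact (sw _ _ _).trans (sw _ _ _)

/-- **Cross identity for a cell**: under (H×), (Hlog), `K₀`'s homotopy at the pair `([toGal]∘g.left, [toGal]∘g.right)`
of a cell `g` post-whiskered into `𝔈` is `cellη g ▷ (𝒩 → 𝔈)` (reflexive cells: both are identities).
[cite: MochizukiAbsTopIII2015, Cor 3.7 (iii) p.88] -/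
theorem coresFamily_η_cellGal_heq
    (hT : ∀ y : X, 𝔖.spaceGal.map (𝔖.iotaTimes.app y) = 𝔖.lamTimesGal.hom.app y ≫ 𝔖.lamTimesPfGal.inv.app y)
    (hL : ∀ A : X, 𝔖.spaceGal.map (𝔖.iotaLog.app A) =
      𝔖.lamTimesGal.hom.app (𝔖.log.obj A) ≫ 𝔖.logGal.hom.app A ≫ 𝔖.lamTimesPfGal.inv.app A)
    {c : Cor37Vertex} (g : StarCell.{u} c)
    (m : 𝔖.coresFamily.E (g.left.cons Cor37Edge.toGal) (g.right.cons Cor37Edge.toGal)) :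
    HEq (𝔖.coresFamily.η m) (Functor.whiskerRight (𝔖.cellη g) 𝔖.spaceGal) := by
  cases g with
  | refl r e =>
    -- the pair is reflexive: both sides are identities
    have H : 𝔖.starDiagram.pathFunctor (((StarCell.refl r e).left).cons Cor37Edge.toGal) =
        𝔖.starDiagram.pathFunctor' (StarCell.refl r e).left ⋙ 𝔖.spaceGal := by
      rw [pathFunctor_eq_pathFunctor']; rfl
    exact (heq_of_eq (𝔖.coresFamily.η_refl m)).trans
      ((id_heq_id H).trans (heq_of_eq (Functor.whiskerRight_id' 𝔖.spaceGal).symm))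
  | times r => exact 𝔖.coresFamily_η_timesGal_heq hT r m
  | log n r => exact 𝔖.coresFamily_η_logGal_heq hL n r m

end BiAnabelianSetting

end Literature.AnabelianGeometry.AbsoluteAnabelian.AbsTopIII
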